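import Mathlib
import HarnessLib

/-!
# Side inequalities (L1), (L5) for the two-copy Harris form are stable under series and parallel attachment of gadgets

Helper file for crux `stmt-CriticalPhenomena-4575` (new-inequality factory `prim-ineq-gen-1`, gen 15); memo
`run/shared/lean/prim/prim-ineq-gen-1/FINDING-21-low-levels-two-sum.md` §4.6.  Companion of `…TwoCopyTwoSum.lean` (2-sum identity)
and `…TwoCopyTwoSumClosure.lean` (conditional closure: the glued form is `≥ 0` once one side satisfies (L1) `AΔ ≤ X` and
(L5) `(1−q)X ≤ ZΔ`).

A SIDE is a finite graph `N` with a glue pair `{x,y}` and a connection event `g`; its blocks are `Z = Z_N[1]`, `A = Z_N[x~y]`,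
`B = Z − A`, `X = Z[x~y ∧ g⁰]·B − A·Z[x≁y ∧ g⁰]`, `Δ = Z[x≁y ∧ g⁺ ∧ ¬g⁰]` (`g⁰`/`g⁺` = the event without/with a virtual edge `xy`).
Attaching an ARBITRARY finite graph `M` (blocks `A' = Z_M[its two contact vertices connected]`, `B' = Z_M − A'`, `Z' = A' + B'`):
* in PARALLEL across `{x,y}`:  `B ↦ B·B'`, `Δ ↦ Δ·B'`, `A ↦ qAA' + AB' + BA'`, `X ↦ B'·((qA' + B')·X + A'·B·Δ)`;
* in SERIES at `y` (glue pair moved to the far contact vertex of `M`):  `Z ↦ Z·Z'`, `A ↦ A·A'`, `Δ ↦ A'·Δ`, `X ↦ A'·Z'·X`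
(memo §4.6; exact identities of generating polynomials up to a common power of `q`, verified on random instances by
`lab/compose_check.py`).  This file proves the resulting FACTORISATIONS
`X_new − A_newΔ_new = B'(qA'+B')·(X − AΔ)` (parallel), `= A'·(Z'X − A A'Δ)` with `Z'X − AA'Δ ≥ Z'(X − AΔ)`-type bound (series), and
`Z_newΔ_new + (q−1)X_new = B'(qA'+B')·(ZΔ + (q−1)X)` (parallel), `= A'Z'·(ZΔ + (q−1)X)` (series),
hence (L1) and (L5) pass from the side to the enlarged side in any ordered commutative ring (`parallel_L1`, `parallel_L5`,
`series_L1`, `series_L5`).  With the base side 'single edge `xy`, event `[x~y]`' (`X = AB`, `Δ = B`: (L1) with equality, (L5) since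
`ZB + (q−1)AB = B(B + qA)`) this yields (L1),(L5) for every ITERATED SIDE and, via `TwoCopyTwoSumClosure.closure_nonneg`, the
two-copy random-cluster Harris inequality for the corresponding 2-sums (memo §4.6, THEOREM T). (This work, 2026-08-21.)
-/

namespace Summit.CriticalPhenomena.PercolationContinuityZ3.Theorems

namespace TwoCopySideClosure

section Identities
variable {R : Type*} [CommRing R]

/-- PARALLEL attachment: the (L1)-defect factorises, `X_new − A_new Δ_new = B'(qA' + B')(X − AΔ)`. [this work] -/
theorem parallel_L1_identity (q A B X Δ A' B' : R) :
    B' * ((q * A' + B') * X + A' * B * Δ) - (q * A * A' + A * B' + B * A') * (Δ * B')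
      = B' * (q * A' + B') * (X - A * Δ) := by
  ring

/-- PARALLEL attachment: the (L5)-form factorises, `Z_newΔ_new + (q−1)X_new = B'(qA'+B')(ZΔ + (q−1)X)` with
`Z_new = qAA' + AB' + BA' + BB'`, `Z = A + B`. [this work] -/
theorem parallel_L5_identity (q A B X Δ A' B' : R) :
    (q * A * A' + A * B' + B * A' + B * B') * (Δ * B') + (q - 1) * (B' * ((q * A' + B') * X + A' * B * Δ))
      = B' * (q * A' + B') * ((A + B) * Δ + (q - 1) * X) := by
  ring

/-- SERIES attachment: the (L1)-defect is `A'(Z'X − AA'Δ)` with `Z' = A' + B'`, and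
`Z'X − AA'Δ = Z'(X − AΔ) + AΔB'`. [this work] -/
theorem series_L1_identity (A X Δ A' B' : R) :
    A' * (A' + B') * X - (A * A') * (A' * Δ) = A' * ((A' + B') * (X - A * Δ) + A * Δ * B') := by
  ring

/-- SERIES attachment: the (L5)-form factorises, `Z_newΔ_new + (q−1)X_new = A'Z'(ZΔ + (q−1)X)`. [this work] -/
theorem series_L5_identity (q Z X Δ A' B' : R) :
    (Z * (A' + B')) * (A' * Δ) + (q - 1) * (A' * (A' + B') * X) = A' * (A' + B') * (Z * Δ + (q - 1) * X) := by
  ring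

/-- BASE side (single edge `xy`, event `[x~y]`): `X = AB`, `Δ = B`, so the (L5)-form is `B(B + qA)`. [this work] -/
theorem base_L5_identity (q A B : R) : (A + B) * B + (q - 1) * (A * B) = B * (B + q * A) := by
  ring

end Identities

section Inequalities
variable {R : Type*} [CommRing R] [PartialOrder R] [IsOrderedRing R]

/-- (L1) survives PARALLEL attachment of any gadget with `A', B' ≥ 0` (and `q ≥ 0`). [this work] -/
theorem parallel_L1 (q A B X Δ A' B' : R) (hq : 0 ≤ q) (hA' : 0 ≤ A') (hB' : 0 ≤ B') (hL1 : A * Δ ≤ X) :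
    (q * A * A' + A * B' + B * A') * (Δ * B') ≤ B' * ((q * A' + B') * X + A' * B * Δ) := by
  have h := parallel_L1_identity q A B X Δ A' B'
  have hnn : 0 ≤ B' * (q * A' + B') * (X - A * Δ) :=
    mul_nonneg (mul_nonneg hB' (add_nonneg (mul_nonneg hq hA') hB')) (sub_nonneg.mpr hL1)
  have : 0 ≤ B' * ((q * A' + B') * X + A' * B * Δ) - (q * A * A' + A * B' + B * A') * (Δ * B') := by rw [h]; exact hnn
  exact sub_nonneg.mp this

/-- (L5) survives PARALLEL attachment of any gadget with `A', B' ≥ 0` (and `q ≥ 0`). [this work] -/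
theorem parallel_L5 (q A B X Δ A' B' : R) (hq : 0 ≤ q) (hA' : 0 ≤ A') (hB' : 0 ≤ B')
    (hL5 : 0 ≤ (A + B) * Δ + (q - 1) * X) :
    0 ≤ (q * A * A' + A * B' + B * A' + B * B') * (Δ * B') + (q - 1) * (B' * ((q * A' + B') * X + A' * B * Δ)) := by
  rw [parallel_L5_identity]
  exact mul_nonneg (mul_nonneg hB' (add_nonneg (mul_nonneg hq hA') hB')) hL5

/-- (L1) survives SERIES attachment of any gadget with `A', B' ≥ 0`, given `A, Δ ≥ 0` on the side. [this work] -/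
theorem series_L1 (A X Δ A' B' : R) (hA : 0 ≤ A) (hΔ : 0 ≤ Δ) (hA' : 0 ≤ A') (hB' : 0 ≤ B') (hL1 : A * Δ ≤ X) :
    (A * A') * (A' * Δ) ≤ A' * (A' + B') * X := by
  have h := series_L1_identity A X Δ A' B'
  have hnn : 0 ≤ A' * ((A' + B') * (X - A * Δ) + A * Δ * B') :=
    mul_nonneg hA' (add_nonneg (mul_nonneg (add_nonneg hA' hB') (sub_nonneg.mpr hL1)) (mul_nonneg (mul_nonneg hA hΔ) hB'))
  have : 0 ≤ A' * (A' + B') * X - (A * A') * (A' * Δ) := by rw [h]; exact hnn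
  exact sub_nonneg.mp this

/-- (L5) survives SERIES attachment of any gadget with `A', B' ≥ 0`. [this work] -/
theorem series_L5 (q Z X Δ A' B' : R) (hA' : 0 ≤ A') (hB' : 0 ≤ B') (hL5 : 0 ≤ Z * Δ + (q - 1) * X) :
    0 ≤ (Z * (A' + B')) * (A' * Δ) + (q - 1) * (A' * (A' + B') * X) := by
  rw [series_L5_identity]
  exact mul_nonneg (mul_nonneg hA' (add_nonneg hA' hB')) hL5

/-- BASE side: (L5) for the single edge with event `[x~y]` (`X = AB`, `Δ = B`), given `A, B, q ≥ 0`. [this work] -/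
theorem base_L5 (q A B : R) (hq : 0 ≤ q) (hA : 0 ≤ A) (hB : 0 ≤ B) : 0 ≤ (A + B) * B + (q - 1) * (A * B) := by
  rw [base_L5_identity]; exact mul_nonneg hB (add_nonneg hB (mul_nonneg hq hA))

end Inequalities

end TwoCopySideClosure

end Summit.CriticalPhenomena.PercolationContinuityZ3.Theorems
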